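import Literature.MathematicalPhysics.QuantumFieldTheory.Balaban1983to89.AveragingImageLawGaugeInvariance
import Literature.MathematicalPhysics.QuantumFieldTheory.Balaban1983to89.B10Eq2HaarCompatibility

/-!
# BalabanUVNodes ∕ N08 — E6′ AT THE RECORD'S AVERAGING HOLDS ON EVERY ONE-BOND σ-ALGEBRA, IN THE STANDING RANGE, EVERY `N`: every single coarse
# bond variable of `(avOfPrint N S j)_*(dU)` is EXACTLY Haar, the image law is coarse-gauge invariant, and for EVERY version `𝔗` of (10) the density
# `T1` of the image law integrates every one-bond observable to its Haar ∕ `dV` value — the in-range TRUE INSTANCE of the E6′ identity that the first module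
# (`…N08HaarCompatibilityInhabited`, p583667) could only exhibit beyond the range; the JOINT law (E6′ proper, NOT IN PRINT) stays undecided at `N ≥ 2`

WIDTH SEAT `pub-ymgap-dag-n08-w3` g0, plan `W-SEAT-START-LIST.md` v4 §n08 item 3 PART 2 (INTENT-2), 2026-08-27.  Track A, DAG node N08 = [Balaban1985UV3] Thm 1
p. 257 (compact) + Thm 2 p. 272; key item K1⁷ `StabilityBAtRecordR13SepCoPH` (stmt-QuantumFields-20542), `--supports … --as helper`.  COUNT-NEUTRAL.

THE INPUT CONSUMED BY NAME.  Cell ym3-torus (seat p2 g12) landed `Literature/…/AveragingImageLawGaugeInvariance.lean`: for EVERY covariant averaging of the standing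
range with measurable `Ū`, on a compact second-countable gauge group, the image law `Ū_*(dU)` is invariant under the coarse gauge group ([Balaban1987RG1] p. 265
«The gauge covariance of the averages implies that the δ-functions in (2.1) are invariant under the gauge transformations V → V^v») and EVERY SINGLE COARSE BOND
VARIABLE IS EXACTLY HAAR DISTRIBUTED (`bondLaw_eq_haar`, uniqueness of normalised Haar measure).  This module READS those theorems at N08's objects of record
— print's averaging `B10RunsOfRecord.avOfPrint N S j` on `Node00.SU N` ([Balaban1987RG1] (0.4) with print's `exp[mean log]`, = the [B10] slot's `Ū`), the
version families `Node00.TFamily₃ N L` of [Balaban1985Averaging] (10) along it (print's `TOfPrint`, the transformations of record `Node00.tOfRecord₃`), every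
lattice approximation `S : Scales L` (so every member of the run family of record, cf. part 1's `exists_member_runsB10OfRecord`) — and turns them into the E6′
LETTERS of `B10Eq2HaarCompatibility` restricted to one-bond observables.

WHAT THIS FILE PROVES (kernel bookkeeping; nothing of Bałaban's asserted; E6′ proper neither proved nor refuted):
* §1 `bondLaw_avOfPrint_eq_haar_of_le` — in the standing range `j + 1 ≤ m + K`, `Law_{dU}(Ū(·)(c)) = Haar` for every coarse bond `c`, every `N ≥ 1`;
  `bondLaw_avOfPrint_eq_haar` — the same at EVERY level (beyond the range from part 1's E6′ `map_avOfPrint_eq_of_not_le` + `AveragingRT.measurePreserving_eval`);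
  `integral_comp_avOfPrint_apply` — `∫ φ(Ū(U)(c)) dU = ∫ φ dHaar` for every a.e.-strongly-measurable `φ`.
* §2 `map_gaugeAct_imageLaw_avOfPrint_of_le` ∕ `map_gaugeAct_imageLaw_avOfPrint` — the image law `(avOfPrint N S j)_*(dU)` is invariant under every coarse gauge
  transformation, in range (covariance) and beyond (it IS `dV`, which is gauge invariant).
* §3 THE LETTER, for EVERY version family `𝔗 : Node00.TFamily₃ N L`, every member, EVERY level, every coarse bond `c`, every bounded measurable `φ : SU(N) → ℝ`:
  `integral_T_one_mul_comp_apply` — `∫ (𝔗 S j).T 1 (V) · φ(V c) dV = ∫ φ dHaar`; `integral_comp_apply_fieldMeasure` — `∫ φ(V c) dV = ∫ φ dHaar`; hence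
  `integral_T_one_mul_comp_apply_eq` — **`∫ T1·(φ ∘ ev_c) dV = ∫ (φ ∘ ev_c) dV`: the E6′ identity `(T1)·dV = dV` HOLDS ON EVERY ONE-BOND σ-ALGEBRA** (the density
  `T1 = d(Ū_*dU)∕dV` has conditional expectation `1` given any single coarse bond variable) and `integral_T_one_sub_one_mul_comp_apply` — the DEFECT
  `T1 − 1` is orthogonal to every one-bond observable; on EVENTS: `setIntegral_T_one_eval_preimage` —
  `∫_{V(c) ∈ A} T1 dV = Haar(A)` and `fieldMeasure_eval_preimage` — `dV{V(c) ∈ A} = Haar(A)`.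
* §4 by name at print's own version and at the transformations OF RECORD: `integral_TOfPrint_one_mul_comp_apply_eq`, `integral_tOfRecord₃_one_mul_comp_apply_eq`.
WHAT IT DOES NOT PROVE (said): E6′ itself — `Ū_*(dU) = dV`, equivalently `T1 =ᵐ 1` (part 1 ∕ `B10Eq2HaarCompatibility.map_avOfPrint_eq_iff`) — concerns the JOINT
law of the coarse bond variables (cycle holonomies: plaquettes on image tori of side ≥ 3, 2-cycles on the side-2 torus of part 1 §4); it is NOT IN PRINT and
undecided at `N ≥ 2` (pub-balaban3d DEPMAP v6 §16 N22; dag-n08-a SEAM note; chair R451).  This file shows exactly how much of it is a theorem at the record: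
all one-bond marginals.

HONEST FRAMING.  Count-neutral helper; N08 NOT discharged; counts unmoved; one finite 𝕋⁴ programme at fixed ε (the d = 3 lattices of [B10] inside the d = 4
record); R4 closes the CONDITIONAL rung `BalabanLadder.UV` only; the Yang–Mills mass gap (Clay) is NOT proved by any of this; nothing continuum ∕ ℝ³ ∕ ℝ⁴ ∕ OS ∕
mass gap.  0 `sorry`, 0 `def`, 0 `instance`, standard axioms.
-/

noncomputable section

open MeasureTheory

namespace Summit.QuantumFields.YangMills.BalabanUVNodes.N08HaarCompatibilityOneBond

open Literature.MathematicalPhysics.QuantumFieldTheory.Balaban1983to89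
open Literature.MathematicalPhysics.QuantumFieldTheory.Balaban1985CMP102.Setting (Scales)
open Literature.MathematicalPhysics.QuantumFieldTheory.Balaban1983to89.B10RunsOfRecord (avOfPrint TOfPrint)
open Literature.MathematicalPhysics.QuantumFieldTheory.Balaban1983to89.B10Eq2HaarCompatibility
open Literature.MathematicalPhysics.QuantumFieldTheory.Balaban1983to89.Node00 (SU TFamily₃ tOfRecord₃)
open Literature.MathematicalPhysics.QuantumFieldTheory.Balaban1983to89.AveragingImageLawGaugeInvariance
  (bondLaw_eq_haar map_gaugeAct_imageLaw map_avg_apply_eq)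
open Literature.MathematicalPhysics.QuantumFieldTheory.Balaban1983to89.B12RTGaugeInvariance254 (measurePreserving_gaugeAct)

variable (N : ℕ) [NeZero N] {L : ℕ}

omit [NeZero N] in
/-- `SU(N)` is second countable (closed subgroup of `M_N(ℂ)`; plumbing as in `AveragingImageLawGaugeInvariance` §3). [folklore] -/
private theorem secondCountableTopology_SU : SecondCountableTopology (SU N) := by
  haveI := secondCountableTopology_matrix (n := Fin N)
  exact Topology.IsEmbedding.subtypeVal.secondCountableTopology

/-! ## §1. Every single coarse bond variable of print's averaging of record is exactly Haar distributed -/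

/-- **IN THE STANDING RANGE every single coarse bond variable of `(avOfPrint N S j)_*(dU)` is EXACTLY Haar**, every `N ≥ 1`, every member, every coarse bond
(ym3-torus's `bondLaw_eq_haar` read at the [B10] slot's averaging). [cite: Balaban1987RG1, (2.1) p.265, (0.4) p.253 (bookkeeping)] -/
theorem bondLaw_avOfPrint_eq_haar_of_le (S : Scales L) {j : ℕ} (hj : j + 1 ≤ S.P.m + S.P.K) (c : PBond S.P (j + 1)) :
    (fieldMeasure S.P j (SU N)).map (fun U => (avOfPrint N S j).avg U c) = (HaarData.haar : Measure (SU N)) := by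
  haveI := secondCountableTopology_SU N
  exact bondLaw_eq_haar hj _ (measurable_avOfPrint N S j) c

/-- **… and at EVERY level** (beyond the range the image law IS `dV`, whose one-bond marginals are Haar). [cite: Balaban1987RG1, (2.1) p.265; Balaban1985UV3, (2) p.256 (bookkeeping)] -/
theorem bondLaw_avOfPrint_eq_haar (S : Scales L) (j : ℕ) (c : PBond S.P (j + 1)) :
    (fieldMeasure S.P j (SU N)).map (fun U => (avOfPrint N S j).avg U c) = (HaarData.haar : Measure (SU N)) := by
  by_cases hj : j + 1 ≤ S.P.m + S.P.K
  · exact bondLaw_avOfPrint_eq_haar_of_le N S hj c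
  · rw [map_avg_apply_eq _ (measurable_avOfPrint N S j) c, map_avOfPrint_eq_of_not_le N S j hj]
    exact (AveragingRT.measurePreserving_eval c).map_eq

/-- `∫ φ(Ū(U)(c)) dU = ∫ φ dHaar` for print's averaging of record, every level, every coarse bond. [cite: Balaban1987RG1, (2.1) p.265 (bookkeeping)] -/
theorem integral_comp_avOfPrint_apply (S : Scales L) (j : ℕ) (c : PBond S.P (j + 1)) (φ : SU N → ℝ)
    (hφ : AEStronglyMeasurable φ (HaarData.haar : Measure (SU N))) :
    ∫ U, φ ((avOfPrint N S j).avg U c) ∂(fieldMeasure S.P j (SU N)) = ∫ h, φ h ∂(HaarData.haar : Measure (SU N)) := by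
  have hmeas : Measurable fun U : GaugeField S.P j (SU N) => (avOfPrint N S j).avg U c :=
    (measurable_pi_apply c).comp (measurable_avOfPrint N S j)
  rw [← bondLaw_avOfPrint_eq_haar N S j c] at hφ ⊢
  exact (integral_map hmeas.aemeasurable hφ).symm

/-! ## §2. The image law of print's averaging of record is coarse-gauge invariant -/

/-- **In the standing range `(avOfPrint N S j)_*(dU)` is invariant under every coarse gauge transformation** ([Balaban1987RG1] p. 265, push-forward form, read at the
[B10] slot's averaging). [cite: Balaban1987RG1, (2.1) p.265 (bookkeeping)] -/
theorem map_gaugeAct_imageLaw_avOfPrint_of_le (S : Scales L) {j : ℕ} (hj : j + 1 ≤ S.P.m + S.P.K) (v : GaugeTransf S.P (j + 1) (SU N)) :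
    ((fieldMeasure S.P j (SU N)).map (avOfPrint N S j).avg).map (GaugeField.gaugeAct v) =
      (fieldMeasure S.P j (SU N)).map (avOfPrint N S j).avg :=
  map_gaugeAct_imageLaw hj _ (measurable_avOfPrint N S j) v

/-- … and at every level (beyond the range the image law is `dV`, gauge invariant by [Balaban1985Averaging] (10)∕(12)). [cite: Balaban1987RG1, (2.1) p.265; Balaban1985Averaging, (12) p.19 (bookkeeping)] -/
theorem map_gaugeAct_imageLaw_avOfPrint (S : Scales L) (j : ℕ) (v : GaugeTransf S.P (j + 1) (SU N)) :
    ((fieldMeasure S.P j (SU N)).map (avOfPrint N S j).avg).map (GaugeField.gaugeAct v) =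
      (fieldMeasure S.P j (SU N)).map (avOfPrint N S j).avg := by
  by_cases hj : j + 1 ≤ S.P.m + S.P.K
  · exact map_gaugeAct_imageLaw_avOfPrint_of_le N S hj v
  · rw [map_avOfPrint_eq_of_not_le N S j hj]
    exact (measurePreserving_gaugeAct v).map_eq

/-! ## §3. The letter: for every version of (10), `T1` integrates every one-bond observable to its Haar ∕ `dV` value -/

/-- `∫ φ(V(c)) dV = ∫ φ dHaar` (one-bond marginal of product Haar). [cite: Balaban1985Averaging, (10) p.19 (bookkeeping)] -/
theorem integral_comp_apply_fieldMeasure (S : Scales L) (j : ℕ) (c : PBond S.P j) (φ : SU N → ℝ)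
    (hφ : AEStronglyMeasurable φ (HaarData.haar : Measure (SU N))) :
    ∫ V, φ (V c) ∂(fieldMeasure S.P j (SU N)) = ∫ h, φ h ∂(HaarData.haar : Measure (SU N)) := by
  have h := (AveragingRT.measurePreserving_eval (P := S.P) (j := j) (G := SU N) c).map_eq
  rw [← h] at hφ ⊢
  exact (integral_map (measurable_pi_apply c).aemeasurable hφ).symm

variable (L) in
/-- **THE E6′ LETTER ON ONE-BOND OBSERVABLES, FOR EVERY VERSION**: for every transformation family `𝔗` of the slot, every member `S`, EVERY level `j`, every coarse bond
`c` and every bounded measurable `φ`, `∫ (𝔗 S j).T 1 (V) · φ(V(c)) dV = ∫ φ dHaar` (the push-forward identity (10) at the test function `φ ∘ ev_c`, then §1).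
[cite: Balaban1985Averaging, (10) p.19; Balaban1987RG1, (2.1) p.265 (bookkeeping)] -/
theorem integral_T_one_mul_comp_apply (𝔗 : TFamily₃ N L) (S : Scales L) (j : ℕ) (c : PBond S.P (j + 1)) (φ : SU N → ℝ)
    (hφm : Measurable φ) (hφb : ∃ C : ℝ, ∀ g, |φ g| ≤ C) :
    ∫ V, (𝔗 S j).T 1 V * φ (V c) ∂(fieldMeasure S.P (j + 1) (SU N)) = ∫ h, φ h ∂(HaarData.haar : Measure (SU N)) := by
  obtain ⟨C, hC⟩ := hφb
  have h := (𝔗 S j).isRT 1 (integrable_const _) (fun V => φ (V c)) (hφm.comp (measurable_pi_apply c)) ⟨C, fun V => hC (V c)⟩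
  rw [h]
  have h1 : (fun U => (1 : Density S.P j (SU N)) U * φ ((avOfPrint N S j).avg U c)) = fun U => φ ((avOfPrint N S j).avg U c) := by
    funext U; simp
  rw [h1]
  exact integral_comp_avOfPrint_apply N S j c φ hφm.aestronglyMeasurable

variable (L) in
/-- **`(T1)·dV = dV` ON EVERY ONE-BOND σ-ALGEBRA**: `∫ T1 · (φ ∘ ev_c) dV = ∫ (φ ∘ ev_c) dV` — the density of `Ū_*(dU)` has conditional expectation `1` given any single
coarse bond variable, for every version, member, level, bond.  (E6′ proper asks `T1 =ᵐ 1`, i.e. the same on the FULL σ-algebra — undecided at `N ≥ 2`.)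
[cite: Balaban1985Averaging, (10) p.19; Balaban1987RG1, (2.1) p.265 (bookkeeping; E6′ NOT IN PRINT)] -/
theorem integral_T_one_mul_comp_apply_eq (𝔗 : TFamily₃ N L) (S : Scales L) (j : ℕ) (c : PBond S.P (j + 1)) (φ : SU N → ℝ)
    (hφm : Measurable φ) (hφb : ∃ C : ℝ, ∀ g, |φ g| ≤ C) :
    ∫ V, (𝔗 S j).T 1 V * φ (V c) ∂(fieldMeasure S.P (j + 1) (SU N)) = ∫ V, φ (V c) ∂(fieldMeasure S.P (j + 1) (SU N)) := by
  rw [integral_T_one_mul_comp_apply N L 𝔗 S j c φ hφm hφb, integral_comp_apply_fieldMeasure N S (j + 1) c φ hφm.aestronglyMeasurable]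

variable (L) in
/-- **THE DEFECT OF E6′ IS ORTHOGONAL TO EVERY ONE-BOND OBSERVABLE**: `∫ ((𝔗 S j).T 1 − 1) · (φ ∘ ev_c) dV = 0` for every version, member, level, bond and bounded
measurable `φ` — whatever the truth of `T1 =ᵐ 1` (E6′ proper). [cite: Balaban1985Averaging, (10) p.19; Balaban1987RG1, (2.1) p.265 (bookkeeping; E6′ NOT IN PRINT)] -/
theorem integral_T_one_sub_one_mul_comp_apply (𝔗 : TFamily₃ N L) (S : Scales L) (j : ℕ) (c : PBond S.P (j + 1)) (φ : SU N → ℝ)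
    (hφm : Measurable φ) (hφb : ∃ C : ℝ, ∀ g, |φ g| ≤ C) :
    ∫ V, ((𝔗 S j).T 1 V - 1) * φ (V c) ∂(fieldMeasure S.P (j + 1) (SU N)) = 0 := by
  obtain ⟨C, hC⟩ := hφb
  have hev : Measurable fun V : GaugeField S.P (j + 1) (SU N) => V c := measurable_pi_apply c
  have hφV : AEStronglyMeasurable (fun V : GaugeField S.P (j + 1) (SU N) => φ (V c)) (fieldMeasure S.P (j + 1) (SU N)) :=
    (hφm.comp hev).aestronglyMeasurable
  have hbd : ∀ᵐ V ∂(fieldMeasure S.P (j + 1) (SU N)), ‖φ (V c)‖ ≤ C :=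
    ae_of_all _ fun V => by rw [Real.norm_eq_abs]; exact hC (V c)
  have h1 : Integrable (fun V => (𝔗 S j).T 1 V * φ (V c)) (fieldMeasure S.P (j + 1) (SU N)) :=
    (integrable_T_one (𝔗 S j)).mul_bdd hφV hbd
  have h2 : Integrable (fun V : GaugeField S.P (j + 1) (SU N) => (1 : ℝ) * φ (V c)) (fieldMeasure S.P (j + 1) (SU N)) :=
    (integrable_const (1 : ℝ)).mul_bdd hφV hbd
  have hsplit : (fun V => ((𝔗 S j).T 1 V - 1) * φ (V c)) =
      fun V => (𝔗 S j).T 1 V * φ (V c) - (1 : ℝ) * φ (V c) := by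
    funext V; ring
  rw [hsplit, integral_sub h1 h2, integral_T_one_mul_comp_apply_eq N L 𝔗 S j c φ hφm ⟨C, hC⟩]
  simp

/-- `dV{V(c) ∈ A} = Haar(A)` for every measurable `A ⊆ SU(N)`. [cite: Balaban1985Averaging, (10) p.19 (bookkeeping)] -/
theorem fieldMeasure_eval_preimage (S : Scales L) (j : ℕ) (c : PBond S.P j) {A : Set (SU N)} (hA : MeasurableSet A) :
    fieldMeasure S.P j (SU N) ((fun V : GaugeField S.P j (SU N) => V c) ⁻¹' A) = (HaarData.haar : Measure (SU N)) A := by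
  have hev : Measurable fun V : GaugeField S.P j (SU N) => V c := measurable_pi_apply c
  rw [← (AveragingRT.measurePreserving_eval (P := S.P) (j := j) (G := SU N) c).map_eq, Measure.map_apply hev hA]

variable (L) in
/-- **ONE-BOND EVENTS**: `∫_{V(c) ∈ A} T1 dV = Haar(A)` for every version, member, level, bond and measurable `A` — with `fieldMeasure_eval_preimage`, the measures
`(T1)·dV` and `dV` agree on every one-bond event. [cite: Balaban1985Averaging, (10) p.19; Balaban1987RG1, (2.1) p.265 (bookkeeping)] -/
theorem setIntegral_T_one_eval_preimage (𝔗 : TFamily₃ N L) (S : Scales L) (j : ℕ) (c : PBond S.P (j + 1)) {A : Set (SU N)}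
    (hA : MeasurableSet A) :
    ∫ V in (fun V : GaugeField S.P (j + 1) (SU N) => V c) ⁻¹' A, (𝔗 S j).T 1 V ∂(fieldMeasure S.P (j + 1) (SU N)) =
      ((HaarData.haar : Measure (SU N)) A).toReal := by
  have hev : Measurable fun V : GaugeField S.P (j + 1) (SU N) => V c := measurable_pi_apply c
  have hmeas : Measurable fun U : GaugeField S.P j (SU N) => (avOfPrint N S j).avg U c := hev.comp (measurable_avOfPrint N S j)
  rw [setIntegral_T_one (𝔗 S j) (measurable_avOfPrint N S j) (hev hA)]
  congr 1
  rw [← bondLaw_avOfPrint_eq_haar N S j c, Measure.map_apply hmeas hA]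
  rfl

/-! ## §4. By name at print's own version `TOfPrint` and at the transformations OF RECORD `tOfRecord₃` -/

/-- The one-bond E6′ identity for print's hypothesis-free version `TOfPrint N`. [cite: Balaban1985Averaging, (10) p.19 (bookkeeping)] -/
theorem integral_TOfPrint_one_mul_comp_apply_eq (S : Scales L) (j : ℕ) (c : PBond S.P (j + 1)) (φ : SU N → ℝ)
    (hφm : Measurable φ) (hφb : ∃ C : ℝ, ∀ g, |φ g| ≤ C) :
    ∫ V, (TOfPrint N S j).T 1 V * φ (V c) ∂(fieldMeasure S.P (j + 1) (SU N)) = ∫ V, φ (V c) ∂(fieldMeasure S.P (j + 1) (SU N)) :=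
  integral_T_one_mul_comp_apply_eq N L (TOfPrint N) S j c φ hφm hφb

variable (L) in
/-- The one-bond E6′ identity for the transformations OF RECORD `Node00.tOfRecord₃ N L` (the version the run family of record is built over).
[cite: Balaban1985UV3, (2) p.256; Balaban1985Averaging, (10) p.19 (bookkeeping)] -/
theorem integral_tOfRecord₃_one_mul_comp_apply_eq (S : Scales L) (j : ℕ) (c : PBond S.P (j + 1)) (φ : SU N → ℝ)
    (hφm : Measurable φ) (hφb : ∃ C : ℝ, ∀ g, |φ g| ≤ C) :
    ∫ V, (tOfRecord₃ N L S j).T 1 V * φ (V c) ∂(fieldMeasure S.P (j + 1) (SU N)) = ∫ V, φ (V c) ∂(fieldMeasure S.P (j + 1) (SU N)) :=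
  integral_T_one_mul_comp_apply_eq N L (tOfRecord₃ N L) S j c φ hφm hφb

end Summit.QuantumFields.YangMills.BalabanUVNodes.N08HaarCompatibilityOneBond

end
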